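import Literature.AlgebraicGeometry.ShimuraVarieties.UnitaryBallAlbaneseAbelianVariety
import Literature.AlgebraicGeometry.AbelianVarieties.PolarisedTorusProjective
import Literature.NumberTheory.Transcendental.AnalytificationMorphisms
import Literature.AlgebraicGeometry.Motives.JacobianDimensionBounds
import Literature.AlgebraicGeometry.Motives.AlbaneseExistenceComplex
import HarnessLib
import Literature.NumberTheory.Transcendental.AnalytificationMorphismsProofs

/-!
# The Albanese variety of a compact ball quotient surface: `alb^* : H¹(Alb X) ≅ H¹(X)`

Layer `Literature/AlgebraicGeometry/ShimuraVarieties`, sequel of `UnitaryBallAlbaneseAbelianVariety` (the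
Albanese torus `T = ℂ^q/Λ` of a smooth projective surface `X` uniformised by the ball carries a Riemann form,
and `alb^* : H¹(T; ℚ) → H¹(X(ℂ); ℚ)` is injective).  THEOREMS ONLY (no definition, no named fact).  We
ALGEBRAISE and conclude:

* `exists_abelianVariety_albanese` — (GAGA) there are an abelian variety `B/ℂ` of dimension `q = h^{1,0}(X)`,
  an analytification `ψ : T ≅ B(ℂ)` which is a group isomorphism (`exists_abelianVariety_of_isAbelianVariety`:
  Lefschetz's theorem + Chow + GAGA for the group law), and a MORPHISM `φ : X ⟶ B` of `ℂ`-schemes with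
  `φ(ℂ) = ψ ∘ alb` on complex points (a holomorphic map between smooth projective varieties is algebraic,
  the record `Arapura2012_Cor_15_4_6`, DISCHARGED by the tree theorem `arapura2012_cor_15_4_6_holds`);
* `injective_bettiCohomology_map_albanese`, `bijective_bettiCohomology_map_albanese` — `φ^*` is injective on
  `H¹(−(ℂ); ℚ)` (`injective_singularCohomology_map_albTop` through the homeomorphism `ψ`), hence BIJECTIVE:
  `b₁(B) = 2 dim B = 2q = b₁(X)` (`AbelianVariety.finrank_bettiCohomology_one_eq_two_mul_dim`,
  `finrank_bettiCohomology_one_eq_two_mul_card`);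
* **`exists_abelianVariety_surjective_bettiCohomology_map`** — for every ball datum `D` of `X`:
  `∃ (B : AbelianVariety ℂ) (φ : X ⟶ B.X), B.dim = h^{1,0}(X) ∧ Bijective (φ^* on H¹(−(ℂ); ℚ))` — the
  hypothesis of the tree's Albanese criterion `Jacobian.isIso_bettiCohomology_map_abelJacobi_of_surjective_of_dim`
  (`Motives/AlbaneseExistenceComplex` §5);
* **`isIso_bettiCohomology_map_abelJacobi`** — hence for EVERY Albanese datum `𝒥` of `X` and every base point,
  `(f^P)^* : H¹(Alb X(ℂ); ℚ) → H¹(X(ℂ); ℚ)` is an isomorphism, `2 dim Alb X = b₁(X)`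
  (`two_mul_dim_eq_finrank_bettiCohomology`) and `dim Alb X = h^{1,0}(X) = q(X)`
  (`jacobian_dim_eq_finrank_hodgeOneZero`): Liu 2021 Lemma 2.4 (1) / Voisin I Thm. 12.15 for compact ball
  quotient surfaces, i.e. the RANGE hypothesis of `Motives/AlbaneseHodgeBlockReach` holds at `X = P_Γ`.

## References

* [VoisinHodgeI2002] C. Voisin, *Hodge Theory and Complex Algebraic Geometry I* (2002), §12.1.2–12.1.3,
  Thm. 12.15, Cor. 12.12.
* [Arapura2012] D. Arapura, *Algebraic Geometry over the Complex Numbers* (2012), §15.4 Cor. 15.4.6.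
* [LangeBirkenhake1992] H. Lange, Ch. Birkenhake, *Complex Abelian Varieties* (1992), §4.1, Thm. 4.2.1.
* [MumfordAV1970] D. Mumford, *Abelian Varieties* (1970), §1 (3), §3 Corollary.
* [Badescu2001] L. Bădescu, *Algebraic Surfaces* (2001), Ch. 5 Def. 5.2, Thm. 5.3.
* [Liu2021] CITED AS PROVENANCE ONLY on proved theorems: Lemma 2.4 (1) (`dim Alb X = q(X)`).
* [GriffithsHarris1978] P. Griffiths, J. Harris, *Principles of Algebraic Geometry* (1978), Ch. 2 §6.
-/

noncomputable section

open scoped Manifold Topology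
open CategoryTheory Function Module
open Literature.Geometry.Kaehler (holFormsInCharts ComplexTorus)
open Literature.NumberTheory.Transcendental
open Literature.AlgebraicTopology.SingularHomology
open Literature.AlgebraicGeometry.Motives (bettiCohomology AbelianVariety Jacobian AlgPoints ComplexPoints
  IsSmoothProjective)
open Literature.AlgebraicGeometry.HodgeTheory

namespace Literature.AlgebraicGeometry.ShimuraVarieties

namespace UnitaryBallUniformisationDatum

variable {X : Motives.SchemeOver ℂ} (D : UnitaryBallUniformisationDatum 2 X)
  (𝔣 : D.SylvesterFrame) {ι : Type} [Fintype ι]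
  (b : Basis ι ℂ (holFormsInCharts (Fin 2 → ℂ) (stdCarrier D.isSmoothProjective).carrier 1))

/-! ### Algebraisation of the Albanese torus and of the Albanese map -/

/-- **The Albanese torus and the Albanese map are algebraic.**  There are a complex abelian variety `B` of
dimension `|ι| = q`, an analytification `ψ : T = ℂ^ι/Λ ≅ B(ℂ)` which is additive-to-multiplicative
(`ψ (x + y) = ψ x · ψ y`), and a morphism `φ : X ⟶ B` of `ℂ`-schemes whose map on complex points is
`ψ ∘ alb` (`T` carries a Riemann form, `isAbelianVariety_albaneseTorus`, hence is the analytic germ of an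
abelian variety, `exists_abelianVariety_of_isAbelianVariety`; `alb` is holomorphic, `mdifferentiable_albMap`,
hence algebraic by the record `Arapura2012_Cor_15_4_6`).
[cite: VoisinHodgeI2002, §12.1.3 Cor. 12.12] [cite: Arapura2012, §15.4 Cor. 15.4.6]
[cite: LangeBirkenhake1992, §4.1 and Thm. 4.2.1] -/
theorem exists_abelianVariety_albanese :
    ∃ (B : AbelianVariety ℂ)
      (ψ : D.AlbaneseTorus (intModel D.isSmoothProjective) 𝔣 b → ComplexPoints B.X) (φ : X ⟶ B.X),
      B.dim = Fintype.card ι ∧ IsAnalytification (ι → ℂ) B.X (Fintype.card ι) ψ ∧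
      (∀ x y, ψ (x + y) = ψ x * ψ y) ∧
      ∀ P : ComplexPoints X, AlgPoints.map φ P = ψ (D.albTop 𝔣 b P) := by
  classical
  have hX := D.isSmoothProjective
  obtain ⟨B, ψ, hdim, hψ, hB, hadd, -, -⟩ :=
    AbelianVarieties.exists_abelianVariety_of_isAbelianVariety
      (D.periodMatrix (intModel hX) 𝔣 b) (D.isAbelianVariety_albaneseTorus 𝔣 b)
  obtain ⟨φ, hφ⟩ := arapura2012_cor_15_4_6_holds X B.X hX hB (intModel hX).model (intModel hX).carrier
    (intModel hX).toComplexPoints (intModel hX).isAnalytification (ι → ℂ)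
    (D.AlbaneseTorus (intModel hX) 𝔣 b) ψ hψ (D.albMap (intModel hX) 𝔣 b)
    (D.mdifferentiable_albMap (intModel hX) 𝔣 b)
  rw [Module.finrank_fintype_fun_eq_card] at hdim hψ
  refine ⟨B, ψ, φ, hdim, hψ, hadd, fun P ↦ ?_⟩
  have hP : (intModel hX).toComplexPoints
      ((stdCarrier hX).isAnalytification.homeomorph.symm P) = P :=
    (stdCarrier hX).isAnalytification.homeomorph.apply_symm_apply P
  have h := hφ ((stdCarrier hX).isAnalytification.homeomorph.symm P)
  rw [hP] at h
  exact h.symm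

/-! ### `φ^*` is bijective on `H¹(−(ℂ); ℚ)` -/

/-- **`φ^* : H¹(B(ℂ); ℚ) → H¹(X(ℂ); ℚ)` is injective** for any morphism `φ : X ⟶ B` with `φ(ℂ) = ψ ∘ alb`,
`ψ : T ≅ B(ℂ)` an analytification: `φ(ℂ)^* = alb^* ∘ ψ^*` with `ψ^*` bijective (`ψ` is a homeomorphism) and
`alb^*` injective (`injective_singularCohomology_map_albTop`: `alb_*` maps `π₁(X(ℂ))` ONTO `π₁(T) = Λ`).
[cite: VoisinHodgeI2002, §12.1.2–12.1.3] [cite: GriffithsHarris1978, Ch. 2 §6] -/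
theorem injective_bettiCohomology_map_albanese {B : AbelianVariety ℂ} {m : ℕ}
    {ψ : D.AlbaneseTorus (intModel D.isSmoothProjective) 𝔣 b → ComplexPoints B.X} {φ : X ⟶ B.X}
    (hψ : IsAnalytification (ι → ℂ) B.X m ψ)
    (hφ : ∀ P : ComplexPoints X, AlgPoints.map φ P = ψ (D.albTop 𝔣 b P)) :
    Function.Injective (bettiCohomology.map φ 1) := by
  -- `φ(ℂ) = ψ ∘ albTop` as continuous maps, `ψ ∘ ψ⁻¹ = id`
  let ψc : C(D.AlbaneseTorus (intModel D.isSmoothProjective) 𝔣 b, ComplexPoints B.X) :=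
    ⟨ψ, hψ.isHomeomorph.continuous⟩
  let ψi : C(ComplexPoints B.X, D.AlbaneseTorus (intModel D.isSmoothProjective) 𝔣 b) :=
    ⟨hψ.homeomorph.symm, hψ.homeomorph.symm.continuous⟩
  have h1 : AlgPoints.mapContinuous (L := ℂ) φ = ψc.comp (D.albTop 𝔣 b) :=
    ContinuousMap.ext fun P ↦ by rw [AlgPoints.mapContinuous_apply, ContinuousMap.comp_apply]; exact hφ P
  have h2 : ψc.comp ψi = ContinuousMap.id _ :=
    ContinuousMap.ext fun y ↦ hψ.homeomorph.apply_symm_apply y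
  -- `ψ^*` is injective (`ψ⁻¹^* ∘ ψ^* = (ψ ∘ ψ⁻¹)^* = id`)
  have hψinj : Function.Injective (singularCohomology.map ℚ ℚ ψc 1) := by
    intro u v huv
    have := congrArg (singularCohomology.map ℚ ℚ ψi 1) huv
    rwa [← ModuleCat.comp_apply, ← ModuleCat.comp_apply, ← singularCohomology.map_comp, h2,
      singularCohomology.map_id, ModuleCat.id_apply, ModuleCat.id_apply] at this
  rw [bettiCohomology.map, h1, singularCohomology.map_comp]
  intro u v huv
  rw [ModuleCat.comp_apply, ModuleCat.comp_apply] at huv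
  exact hψinj (D.injective_singularCohomology_map_albTop 𝔣 b huv)

/-- **`φ^* : H¹(B(ℂ); ℚ) → H¹(X(ℂ); ℚ)` is bijective** when moreover `dim B = |ι| = q`: it is injective
(`injective_bettiCohomology_map_albanese`) between `ℚ`-spaces of the same dimension,
`b₁(B) = 2 dim B` (Mumford §1 (3), `AbelianVariety.finrank_bettiCohomology_one_eq_two_mul_dim`) and
`b₁(X) = 2 h^{1,0}(X) = 2q` (`finrank_bettiCohomology_one_eq_two_mul_card`).
[cite: VoisinHodgeI2002, §12.1.3 Thm. 12.15] [cite: MumfordAV1970, §1 (3) (p. 3)] -/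
theorem bijective_bettiCohomology_map_albanese {B : AbelianVariety ℂ} {m : ℕ}
    {ψ : D.AlbaneseTorus (intModel D.isSmoothProjective) 𝔣 b → ComplexPoints B.X} {φ : X ⟶ B.X}
    (hdim : B.dim = Fintype.card ι) (hψ : IsAnalytification (ι → ℂ) B.X m ψ)
    (hφ : ∀ P : ComplexPoints X, AlgPoints.map φ P = ψ (D.albTop 𝔣 b P)) :
    Function.Bijective (bettiCohomology.map φ 1) := by
  have hX := D.isSmoothProjective
  haveI := Motives.finite_bettiCohomology_of_isSmoothProjective hX 1
  haveI := Motives.finite_bettiCohomology_of_isSmoothProjective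
    (show IsSmoothProjective B.dim B.X from AbelianVariety.isSmoothProjective_holds) 1
  have hinj := D.injective_bettiCohomology_map_albanese 𝔣 b hψ hφ
  have heq : finrank ℚ (bettiCohomology B.X 1) = finrank ℚ (bettiCohomology X 1) := by
    rw [B.finrank_bettiCohomology_one_eq_two_mul_dim, hdim,
      D.finrank_bettiCohomology_one_eq_two_mul_card (intModel hX) b]
  exact ⟨hinj, (LinearMap.injective_iff_surjective_of_finrank_eq_finrank
    (f := (bettiCohomology.map φ 1).hom) heq).mp hinj⟩

/-! ### The Albanese criterion for compact ball quotient surfaces -/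

/-- **Some morphism from a compact ball quotient surface to an abelian variety is bijective on
`H¹(−(ℂ); ℚ)`.**  For every ball datum `D` of the smooth projective surface `X` (the records
`Arapura2012_Cor_15_4_6` and `exists_isReal_hodgeModel` being tree theorems, nothing is assumed): there are an abelian variety
`B/ℂ` of dimension `h^{1,0}(X)` and `φ : X ⟶ B` with `φ^* : H¹(B(ℂ); ℚ) ≅ H¹(X(ℂ); ℚ)` — the algebraised
analytic Albanese `X → ℂ^q/Λ` (`exists_abelianVariety_albanese`, `bijective_bettiCohomology_map_albanese`,
for a Sylvester frame and a basis of `Ω¹(X^an)` chosen inside the proof).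
[cite: VoisinHodgeI2002, §12.1.3 Thm. 12.15 and Cor. 12.12] [cite: Liu2021, Lemma 2.4 (1)] -/
theorem exists_abelianVariety_surjective_bettiCohomology_map :
    ∃ (B : AbelianVariety ℂ) (φ : X ⟶ B.X),
      B.dim = finrank ℂ (hodgeOneZero D.isSmoothProjective) ∧
        Function.Bijective (bettiCohomology.map φ 1) := by
  classical
  have hX := D.isSmoothProjective
  obtain ⟨𝔣⟩ := D.nonempty_sylvesterFrame
  haveI := Motives.finite_bettiCohomology_of_isSmoothProjective hX 1
  haveI : Module.Finite ℂ (holFormsInCharts (Fin 2 → ℂ) (stdCarrier hX).carrier 1) :=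
    Module.Finite.equiv ((intModel hX).ratPieceOneEquivFormsSurface hX)
  let b := Module.finBasis ℂ (holFormsInCharts (Fin 2 → ℂ) (stdCarrier hX).carrier 1)
  obtain ⟨B, ψ, φ, hdim, hψ, -, hφ⟩ := D.exists_abelianVariety_albanese 𝔣 b
  refine ⟨B, φ, ?_, D.bijective_bettiCohomology_map_albanese 𝔣 b hdim hψ hφ⟩
  rw [hdim, Fintype.card_fin]
  exact D.finrank_holFormsInCharts_eq_finrank_hodgeOneZero (intModel hX)

include D in
/-- **`b₁(X) ≤ 2 dim Alb X`** for every Albanese datum `𝒥` of a compact ball quotient surface `X`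
(`Jacobian.finrank_bettiCohomology_le_two_mul_dim_of_surjective` on the morphism of
`exists_abelianVariety_surjective_bettiCohomology_map`): the RANGE hypothesis `hb` of
`Jacobian.exists_cmType_hom_ne_zero_of_allOrNothing_submodule_of_finrank_le` (`Motives/AlbaneseHodgeBlockReach`).
[cite: Badescu2001, Ch. 5 Def. 5.2 and Thm. 5.3] [cite: Liu2021, Lemma 2.4 (1)] -/
theorem finrank_bettiCohomology_le_two_mul_dim (𝒥 : Jacobian X) :
    finrank ℚ (bettiCohomology X 1) ≤ 2 * 𝒥.J.dim := by
  obtain ⟨P⟩ := D.isSmoothProjective.nonempty_algPoints ℂ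
  obtain ⟨B, φ, -, hφ⟩ := D.exists_abelianVariety_surjective_bettiCohomology_map
  exact 𝒥.finrank_bettiCohomology_le_two_mul_dim_of_surjective P φ hφ.2

include D in
/-- **`2 dim Alb X = b₁(X)`** for a compact ball quotient surface (with the tree's
`Jacobian.two_mul_dim_le_finrank_bettiCohomology_of_dim`). [cite: Badescu2001, Ch. 5 Thm. 5.3]
[cite: VoisinHodgeI2002, §12.1.3 Thm. 12.15] -/
theorem two_mul_dim_eq_finrank_bettiCohomology (𝒥 : Jacobian X) :
    2 * 𝒥.J.dim = finrank ℚ (bettiCohomology X 1) :=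
  Motives.Jacobian.two_mul_dim_eq_finrank_bettiCohomology_of_finrank_le_of_dim D.isSmoothProjective 𝒥
    (D.finrank_bettiCohomology_le_two_mul_dim 𝒥)

/-- **`dim Alb X = h^{1,0}(X) = q(X)`** for a compact ball quotient surface (Liu 2021 Lemma 2.4 (1); from
`2 dim Alb X = b₁(X) = 2 h^{1,0}(X)`, `finrank_bettiCohomology_one_eq_two_mul_finrank_hodgeOneZero`).
[cite: Liu2021, Lemma 2.4 (1)] [cite: VoisinHodgeI2002, §12.1.3 Thm. 12.15] -/
theorem jacobian_dim_eq_finrank_hodgeOneZero (𝒥 : Jacobian X) :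
    𝒥.J.dim = finrank ℂ (hodgeOneZero D.isSmoothProjective) := by
  have h := D.two_mul_dim_eq_finrank_bettiCohomology 𝒥
  rw [finrank_bettiCohomology_one_eq_two_mul_finrank_hodgeOneZero D.isSmoothProjective] at h
  omega

include D in
/-- **ISO(`X`): `(f^P)^* : H¹(Alb X(ℂ); ℚ) → H¹(X(ℂ); ℚ)` is an isomorphism** for every Albanese datum `𝒥`
and every base point `P` of a compact ball quotient surface `X` (the tree's Albanese criterion
`Jacobian.isIso_bettiCohomology_map_abelJacobi_of_surjective_of_dim` on
`exists_abelianVariety_surjective_bettiCohomology_map`).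
[cite: VoisinHodgeI2002, §12.1.3 Thm. 12.15] [cite: Badescu2001, Ch. 5 Thm. 5.3] [cite: Liu2021, Lemma 2.4 (1)] -/
theorem isIso_bettiCohomology_map_abelJacobi (𝒥 : Jacobian X) (P : AlgPoints X ℂ) :
    IsIso (bettiCohomology.map (𝒥.abelJacobi P) 1) := by
  obtain ⟨B, φ, -, hφ⟩ := D.exists_abelianVariety_surjective_bettiCohomology_map
  exact 𝒥.isIso_bettiCohomology_map_abelJacobi_of_surjective_of_dim D.isSmoothProjective P φ hφ.2

include D in
/-- The same as a bijection of `ℚ`-vector spaces. [cite: VoisinHodgeI2002, §12.1.3 Thm. 12.15] -/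
theorem bijective_bettiCohomology_map_abelJacobi (𝒥 : Jacobian X) (P : AlgPoints X ℂ) :
    Function.Bijective (bettiCohomology.map (𝒥.abelJacobi P) 1) := by
  haveI := D.isIso_bettiCohomology_map_abelJacobi 𝒥 P
  exact ConcreteCategory.bijective_of_isIso (bettiCohomology.map (𝒥.abelJacobi P) 1)

end UnitaryBallUniformisationDatum

end Literature.AlgebraicGeometry.ShimuraVarieties

end
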